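import Summits.CriticalPhenomena.PercolationContinuityZ3.Theorems.PercNearOneGluingAdditiveGluingFingerPatternValues
import HarnessLib

/-! # Crux `PercNearOneGluing.AdditiveGluing` (stmt-CriticalPhenomena-4576) — pattern reliabilities of RESTRICTED events and of the glued block
# (any number of contact relays; seat (b) V⁺-form, depth prover `png-dp-vplus`)

Support file (`--supports stmt-CriticalPhenomena-4576`); no definitions, no named facts.  Continues `…FingerPatternValues.lean`:
* `determinedBy_offBlock`: an event read on the pairs avoiding `N` is determined by them;
* `real_openConn_notReach_eq_of_blockPairs_nd`: the loop-tolerant detour identity for the RESTRICTED event `{y ↔ b} ∩ {d ↮ c}` (all four outside `N`) —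
  these are the events of the Lemma-3(ii)-restricted hypotheses `μ_K(a↔b, c ∉ C_d) − μ_K(d↔b, c ∉ C_d) ≥ 0`;
* `real_openConn_notReach_pinW_unglued_bridge`: its value in the un-glued pattern weighting `pinW K F J` (bridge graph `B_J`);
* `real_blockReach_pinW_glued_gen`: in `pinW (K/N) F J` the glued block reaches `b` exactly when a touched relay does (general `F`).
[folklore; KozmaNitzan2024 §3.1, §4 p. 20]
-/

namespace Summit.CriticalPhenomena.PercolationContinuityZ3.Theorems

open MeasureTheory Set
open Literature.Probability.LatticeModels (prodBernoulli)
open Literature.Probability.Percolation (BondConfig openConn openGraph pinW localCylinder DeterminedBy determinedBy_iff)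

noncomputable section
open Classical

section FingerPatternValuesB

open Literature.Probability.LatticeModels Literature.Probability.Percolation

variable {n : ℕ}

/-- An event that only reads the pairs avoiding `N` is determined by the pairs avoiding `N`. [folklore] -/
theorem determinedBy_offBlock (N : Finset (Fin n)) (P : Set (Sym2 (Fin n)) → Prop) :
    DeterminedBy {ω : BondConfig (Fin n) | P {e | e ∈ ω ∧ ∀ z ∈ e, z ∉ N}} {e : Sym2 (Fin n) | ∀ z ∈ e, z ∉ N} := by
  rw [determinedBy_iff]
  intro ω₁ ω₂ h
  have : ({e | e ∈ ω₁ ∧ ∀ z ∈ e, z ∉ N} : Set (Sym2 (Fin n))) = {e | e ∈ ω₂ ∧ ∀ z ∈ e, z ∉ N} := by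
    ext e
    have he := Set.ext_iff.1 h e
    simp only [Set.mem_inter_iff, Set.mem_setOf_eq] at he ⊢
    constructor
    · rintro ⟨h1, h2⟩; exact ⟨(he.1 ⟨h1, h2⟩).1, h2⟩
    · rintro ⟨h1, h2⟩; exact ⟨(he.2 ⟨h1, h2⟩).1, h2⟩
  simp only [Set.mem_setOf_eq, this]

/-- **Restricted reliability as a base quantity (loops ignored).**  As `real_openConn_eq_of_blockPairs_nd`, for the event `{y ↔ b} ∩ {d ↮ c}`
with `y, b, d, c ∉ N`: `μ_p(y↔b, d↮c) = μ_q{ω | y ↔ b and d ↮ c in (ω ∖ pairs at N) ∪ Q}`. [folklore; KozmaNitzan2024 §4 p. 20] -/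
theorem real_openConn_notReach_eq_of_blockPairs_nd (p q : Sym2 (Fin n) → unitInterval) (N : Finset (Fin n)) (O : Finset (Sym2 (Fin n)))
    (Q : Set (Sym2 (Fin n)))
    (h1 : ∀ e ∈ O, p e = 1) (h0 : ∀ e : Sym2 (Fin n), e ∉ O → ¬ e.IsDiag → (∃ z ∈ e, z ∈ N) → p e = 0)
    (hQ : ∀ e ∈ Q, ∀ z ∈ e, z ∉ N)
    (ha : ∀ e ∈ Q, ∀ u ∈ e, ∀ u' ∈ e, (openGraph (↑O : Set (Sym2 (Fin n)))).Reachable u u')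
    (hb : ∀ u u' : Fin n, u ∉ N → u' ∉ N → (openGraph (↑O : Set (Sym2 (Fin n)))).Reachable u u' → (openGraph Q).Reachable u u')
    (hpq : ∀ e : Sym2 (Fin n), (∀ z ∈ e, z ∉ N) → p e = q e) {y b d c : Fin n} (hy : y ∉ N) (hbN : b ∉ N) (hd : d ∉ N) (hc : c ∉ N) :
    (prodBernoulli p).real (openConn y b ∩ {ω : BondConfig (Fin n) | ¬ (openGraph ω).Reachable d c}) =
      (prodBernoulli q).real {ω : BondConfig (Fin n) |
        (openGraph (({e | e ∈ ω ∧ ∀ z ∈ e, z ∉ N} ∪ Q : Set (Sym2 (Fin n))) : BondConfig (Fin n))).Reachable y b ∧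
        ¬ (openGraph (({e | e ∈ ω ∧ ∀ z ∈ e, z ∉ N} ∪ Q : Set (Sym2 (Fin n))) : BondConfig (Fin n))).Reachable d c} := by
  set E : Set (BondConfig (Fin n)) := {ω : BondConfig (Fin n) |
    (openGraph (({e | e ∈ ω ∧ ∀ z ∈ e, z ∉ N} ∪ Q : Set (Sym2 (Fin n))) : BondConfig (Fin n))).Reachable y b ∧
    ¬ (openGraph (({e | e ∈ ω ∧ ∀ z ∈ e, z ∉ N} ∪ Q : Set (Sym2 (Fin n))) : BondConfig (Fin n))).Reachable d c} with hE
  have hae : ∀ᵐ ω ∂(prodBernoulli p), ω ∈ (openConn y b ∩ {ω : BondConfig (Fin n) | ¬ (openGraph ω).Reachable d c}) ↔ ω ∈ E := by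
    filter_upwards [ae_openGraph_eq_blockPairs p N O h1 h0] with ω hω
    have hω' : ∀ e ∈ ({e | e ∈ ω ∧ ∀ z ∈ e, z ∉ N} : Set (Sym2 (Fin n))), ∀ z ∈ e, z ∉ N := fun e he => he.2
    have key1 := reach_detour_iff N (ω' := {e | e ∈ ω ∧ ∀ z ∈ e, z ∉ N}) (O := (↑O : Set (Sym2 (Fin n)))) (Q := Q)
      hω' hQ ha hb hy hbN
    have key2 := reach_detour_iff N (ω' := {e | e ∈ ω ∧ ∀ z ∈ e, z ∉ N}) (O := (↑O : Set (Sym2 (Fin n)))) (Q := Q)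
      hω' hQ ha hb hd hc
    show ((openGraph ω).Reachable y b ∧ ¬ (openGraph ω).Reachable d c) ↔ _
    rw [hω]
    exact and_congr key1 (not_congr key2)
  have heq : (openConn y b ∩ {ω : BondConfig (Fin n) | ¬ (openGraph ω).Reachable d c} : Set (BondConfig (Fin n))) =ᵐ[prodBernoulli p] E :=
    hae.mono fun ω h => propext h
  rw [measureReal_congr heq]
  refine prodBernoulli_real_eq_of_determinedBy p q (fun e he => hpq e he) ?_ MeasurableSet.of_discrete
  exact determinedBy_offBlock N (fun S => (openGraph ((S ∪ Q : Set (Sym2 (Fin n))) : BondConfig (Fin n))).Reachable y b ∧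
    ¬ (openGraph ((S ∪ Q : Set (Sym2 (Fin n))) : BondConfig (Fin n))).Reachable d c)

/-- **Restricted un-glued pattern reliability, general contact set.**  As `real_openConn_pinW_unglued_bridge`, for the event `{y↔b} ∩ {d ↮ c}`
(`y, b, d, c ∉ N`): its value under `pinW K F J` is `μ_q{y ↔ b and d ↮ c in (ω∖pairs at N) ∪ B_J}`. [folklore; KozmaNitzan2024 §4 p. 20] -/
theorem real_openConn_notReach_pinW_unglued_bridge (K : Sym2 (Fin n) → unitInterval) (N : Finset (Fin n)) (F J : Finset (Sym2 (Fin n)))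
    (hF : ∀ e ∈ F, ∃ v ∈ N, ∃ w ∉ N, e = s(v, w)) (hJF : J ⊆ F)
    (hK0 : ∀ e : Sym2 (Fin n), e ∉ F → ¬ e.IsDiag → (∃ z ∈ e, z ∈ N) → K e = 0)
    {y b d c : Fin n} (hy : y ∉ N) (hbN : b ∉ N) (hd : d ∉ N) (hc : c ∉ N) :
    (prodBernoulli (pinW K (↑F : Set (Sym2 (Fin n))) ↑J)).real (openConn y b ∩ {ω : BondConfig (Fin n) | ¬ (openGraph ω).Reachable d c}) =
      (prodBernoulli (fun e : Sym2 (Fin n) => if (∃ z ∈ e, z ∈ N) then (0 : unitInterval) else K e)).real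
        {ω : BondConfig (Fin n) |
          (openGraph (({e | e ∈ ω ∧ ∀ z ∈ e, z ∉ N} ∪
            {e : Sym2 (Fin n) | ∃ v ∈ N, ∃ w w' : Fin n, w ∉ N ∧ w' ∉ N ∧ w ≠ w' ∧ s(v, w) ∈ J ∧ s(v, w') ∈ J ∧ e = s(w, w')} :
              Set (Sym2 (Fin n))) : BondConfig (Fin n))).Reachable y b ∧
          ¬ (openGraph (({e | e ∈ ω ∧ ∀ z ∈ e, z ∉ N} ∪
            {e : Sym2 (Fin n) | ∃ v ∈ N, ∃ w w' : Fin n, w ∉ N ∧ w' ∉ N ∧ w ≠ w' ∧ s(v, w) ∈ J ∧ s(v, w') ∈ J ∧ e = s(w, w')} :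
              Set (Sym2 (Fin n))) : BondConfig (Fin n))).Reachable d c} := by
  have hJ : ∀ e ∈ J, ∃ v ∈ N, ∃ w ∉ N, e = s(v, w) := fun e he => hF e (hJF he)
  refine real_openConn_notReach_eq_of_blockPairs_nd _ _ N J _ ?_ ?_ ?_ ?_ ?_ ?_ hy hbN hd hc
  · intro e he
    exact pinW_apply_of_mem_of_mem K (Finset.mem_coe.2 (hJF he)) (Finset.mem_coe.2 he)
  · intro e heJ hnd hz
    by_cases heF : e ∈ F
    · exact pinW_apply_of_mem_of_not_mem K (Finset.mem_coe.2 heF) (fun h => heJ (Finset.mem_coe.1 h))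
    · rw [pinW_apply_of_not_mem K _ (fun h => heF (Finset.mem_coe.1 h))]
      exact hK0 e heF hnd hz
  · rintro e ⟨v, hv, w, w', hw, hw', hne, h1, h2, rfl⟩ z hz
    rcases Sym2.mem_iff.1 hz with rfl | rfl
    · exact hw
    · exact hw'
  · rintro e ⟨v, hv, w, w', hw, hw', hne, h1, h2, rfl⟩ u hu u' hu'
    have hreach : ∀ x ∈ s(w, w'), (openGraph (↑J : Set (Sym2 (Fin n)))).Reachable v x := by
      intro x hx
      rcases Sym2.mem_iff.1 hx with rfl | rfl
      · exact ((openGraph_adj _ v x).2 ⟨Finset.mem_coe.2 h1, fun h => hw (h ▸ hv)⟩).reachable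
      · exact ((openGraph_adj _ v x).2 ⟨Finset.mem_coe.2 h2, fun h => hw' (h ▸ hv)⟩).reachable
    exact (hreach u hu).symm.trans (hreach u' hu')
  · intro u u' hu hu' h
    exact detour_b_bridge N J hJ u u' hu hu' h
  · intro e he
    have heF : e ∉ (↑F : Set (Sym2 (Fin n))) := by
      intro heF
      obtain ⟨v, hv, w, -, rfl⟩ := hF e (Finset.mem_coe.1 heF)
      exact he v (Sym2.mem_mk_left v w) hv
    rw [pinW_apply_of_not_mem K _ heF]
    have : ¬ (∃ z ∈ e, z ∈ N) := fun ⟨z, hz, hzN⟩ => he z hz hzN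
    simp only [this, if_false]

/-- **The glued block reaches `b` exactly when a touched relay does (general contact set).**  `g = K/N`, `F` contact pairs, `J ⊆ F` touching the
relay `w` (some `s(v₁, w) ∈ J`, `v₁ ∈ N`, `w ∉ N`): `μ_{pinW g F J}(⋃_{v∈N} {v ↔ b}) = μ_{pinW g F J}(w ↔ b)`. [folklore] -/
theorem real_blockReach_pinW_glued_gen (K : Sym2 (Fin n) → unitInterval) (N : Finset (Fin n)) (F J : Finset (Sym2 (Fin n))) (b : Fin n)
    (hF : ∀ e ∈ F, ∃ v ∈ N, ∃ w ∉ N, e = s(v, w)) (hJF : J ⊆ F)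
    {w v₁ : Fin n} (hv₁ : v₁ ∈ N) (hwN : w ∉ N) (hv₁J : s(v₁, w) ∈ J) :
    (prodBernoulli (pinW (fun e' : Sym2 (Fin n) => if (∀ z ∈ e', z ∈ N) ∧ ¬ e'.IsDiag then 1 else K e')
        (↑F : Set (Sym2 (Fin n))) ↑J)).real (⋃ v ∈ N, openConn v b) =
      (prodBernoulli (pinW (fun e' : Sym2 (Fin n) => if (∀ z ∈ e', z ∈ N) ∧ ¬ e'.IsDiag then 1 else K e')
        (↑F : Set (Sym2 (Fin n))) ↑J)).real (openConn w b) := by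
  set g : Sym2 (Fin n) → unitInterval := fun e' => if (∀ z ∈ e', z ∈ N) ∧ ¬ e'.IsDiag then 1 else K e' with hg
  set p : Sym2 (Fin n) → unitInterval := pinW g (↑F : Set (Sym2 (Fin n))) ↑J with hp
  set I : Finset (Sym2 (Fin n)) := ((N ×ˢ N).filter (fun vv : Fin n × Fin n => vv.1 ≠ vv.2)).image
    (fun vv => s(vv.1, vv.2)) with hI
  have hJopen : ∀ᵐ ω ∂(prodBernoulli p), s(v₁, w) ∈ ω :=
    prodBernoulli_ae_mem_of_eq_one p (pinW_apply_of_mem_of_mem g (Finset.mem_coe.2 (hJF hv₁J)) (Finset.mem_coe.2 hv₁J))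
  have hIopen : ∀ᵐ ω ∂(prodBernoulli p), ∀ e ∈ I, e ∈ ω := by
    refine (Filter.eventually_all_finset I).2 fun e he => prodBernoulli_ae_mem_of_eq_one p ?_
    obtain ⟨⟨v, v'⟩, hvv, rfl⟩ := Finset.mem_image.1 he
    obtain ⟨hvv', hne⟩ := Finset.mem_filter.1 hvv
    obtain ⟨hv, hv'⟩ := Finset.mem_product.1 hvv'
    have hin : (∀ z ∈ s(v, v'), z ∈ N) ∧ ¬ (s(v, v')).IsDiag := by
      refine ⟨fun z hz => ?_, fun h => hne (Sym2.mk_isDiag_iff.1 h)⟩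
      rcases Sym2.mem_iff.1 hz with rfl | rfl
      · exact hv
      · exact hv'
    have hnotF : s(v, v') ∉ (↑F : Set (Sym2 (Fin n))) :=
      fun heF => contactPair_not_internal N F hF _ (Finset.mem_coe.1 heF) hin.1
    rw [hp, pinW_apply_of_not_mem g _ hnotF]
    show (if (∀ z ∈ s(v, v'), z ∈ N) ∧ ¬ (s(v, v')).IsDiag then (1 : unitInterval) else K s(v, v')) = 1
    rw [if_pos hin]
  have hae : (⋃ v ∈ N, openConn v b : Set (BondConfig (Fin n))) =ᵐ[prodBernoulli p] (openConn w b : Set (BondConfig (Fin n))) := by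
    filter_upwards [hJopen, hIopen] with ω hωJ hωI
    have hvw : ∀ v ∈ N, (openGraph ω).Reachable v w := by
      intro v hv
      have hv1 : (openGraph ω).Reachable v v₁ := by
        by_cases hvv : v = v₁
        · rw [hvv]
        · exact ((openGraph_adj ω v v₁).2 ⟨hωI _ (Finset.mem_image.2 ⟨(v, v₁),
            Finset.mem_filter.2 ⟨Finset.mem_product.2 ⟨hv, hv₁⟩, hvv⟩, rfl⟩), hvv⟩).reachable
      exact hv1.trans ((openGraph_adj ω v₁ w).2 ⟨hωJ, fun h => hwN (h ▸ hv₁)⟩).reachable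
    refine propext ?_
    change ω ∈ (⋃ v ∈ N, (openConn v b : Set (BondConfig (Fin n)))) ↔ ω ∈ (openConn w b : Set (BondConfig (Fin n)))
    simp only [Set.mem_iUnion, exists_prop]
    constructor
    · rintro ⟨v, hv, hvb⟩
      exact (hvw v hv).symm.trans hvb
    · intro hwb
      exact ⟨v₁, hv₁, (hvw v₁ hv₁).trans hwb⟩
  exact measureReal_congr hae

end FingerPatternValuesB

end

end Summit.CriticalPhenomena.PercolationContinuityZ3.Theorems
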